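import Literature.Analysis.FluidPDE.ClassicalSuitable
import HarnessLib

/-!
# Gluing weak solutions of the Navier–Stokes inequality along a sequence of switching times, I

Barrier-catalogue support file for `NavierStokesRegularity` (D-0021), serving the discharge of
Scheffer's switching argument (`IsNSIBlock.switching` / `NSISwitching`; Scheffer 1985,
Lemma 2.3; W. S. Ożański, arXiv:1709.00602, §1–§2). Ożański isolates the principle behind the
construction (§1, after Thm. 2, the "alternative form" (1.6) of the local energy inequality):
*a necessary and sufficient condition for two vector fields `u⁽¹⁾` on `[t₀,t₁]`, `u⁽²⁾` on
`[t₁,t₂]`, each satisfying the local energy inequality with boundary terms on its interval, to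
combine one after another into a field satisfying the local energy inequality on `[t₀,t₂]` is
`|u⁽²⁾(x,t₁)| ≤ |u⁽¹⁾(x,t₁)|` for a.e. `x`*; in §2 this is iterated along `t_j ↑ T₀` and the
limit `S' → T₀` is taken by dominated convergence.

This file and its sequel `NavierStokesInequalityGluingLEI.lean` prove that principle in the
abstract, for the tree's rendering `IsWeakNSISolution` of Ożański's Def. 1.1 (2020): a field
`𝔲 : ℝ × E → E` (`E` a finite-dimensional real inner product space; `E = ℝ³` in the application) which on each piece `[t_j, t_{j+1})` of a partition `0 = t₀ < t₁ < ⋯ ↑ T₀`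
agrees with `C¹` divergence-free slices `v_j(s)` (and its pressure / gradient with `q_j(s)` /
`D v_j(s)`), vanishes from `T₀` on, and has the global integrability the local energy inequality
needs, is weakly divergence free and has the glued classical derivative as weak spatial gradient
(this file); and if moreover each piece satisfies the local energy inequality with boundary terms
and the magnitudes drop at the switching times, `𝔲` satisfies the local energy inequality and is
a weak NSI solution (the sequel). Nothing here refers to Scheffer's particular rescaled pieces.

## Contents

* partition of `[0, T₀)` by a strictly increasing sequence `t_j → T₀` with `t₀ = 0`
  (`exists_mem_Ico_of_strictMono_tendsto`, `iUnion_Ico_eq_of_strictMono_tendsto`, disjointness)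
  and the corresponding space–time strips;
* slice identities: `∫ ⟪V, ∇θ⟫ = 0` for `V ∈ C¹` divergence free and `θ ∈ C¹_c`
  (`integral_inner_gradient_eq_zero_of_isDivFree`), `∫ ∂ᵥφ ⟪V, w⟫ = -∫ φ ⟪DV v, w⟫`
  (`integral_fderiv_mul_inner_eq_neg`);
* `hasWeakSpatialGradientOn_of_piecewise` — the glued slice derivative is a weak spatial
  gradient of the glued field on `(0,∞) × E`;
* `integral_inner_gradient_eq_zero_of_piecewise` — the glued field is weakly divergence free.

## References

* W. S. Ożański, *On weak solutions to the Navier–Stokes inequality with internal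
  singularities*, arXiv:1709.00602 (2017), §1 (1.6) and the paragraph after it, §2 pp. 6–7.
  [`Ozanski2017NSISingular`]
* V. Scheffer, Comm. Math. Phys. 101 (1985), proof of Lemma 2.3 ((2.32)–(2.34)). [`Scheffer1985`]
* W. S. Ożański, Comm. Math. Phys. 374 (2020), Def. 1.1. [`Ozanski2019NSI`]
-/

noncomputable section

open MeasureTheory Set Function Filter Topology TopologicalSpace Metric
open scoped ENNReal InnerProductSpace RealInnerProductSpace ContDiff Laplacian

namespace Literature.Barriers.NavierStokesRegularity

open Literature.Analysis.FluidPDE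

variable {E : Type*} [NormedAddCommGroup E] [InnerProductSpace ℝ E] [FiniteDimensional ℝ E]
  [MeasurableSpace E] [BorelSpace E]

/-! ### Partition of `[0, T₀)` by switching times -/

section Partition

variable {t : ℕ → ℝ} {T₀ : ℝ}

/-- A strictly increasing sequence stays below its limit. [folklore] -/
theorem lt_of_strictMono_tendsto (ht : StrictMono t) (hT : Tendsto t atTop (𝓝 T₀)) (j : ℕ) :
    t j < T₀ :=
  (ht (Nat.lt_succ_self j)).trans_le (ht.monotone.ge_of_tendsto hT (j + 1))

/-- **Every time in `[t₀, T₀)` lies in some piece `[t_j, t_{j+1})`** of the partition by a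
strictly increasing sequence `t_j → T₀`. [cite: Ozanski2017NSISingular, §2 (2.4)] -/
theorem exists_mem_Ico_of_strictMono_tendsto (hT : Tendsto t atTop (𝓝 T₀)) {s : ℝ} (hs₀ : t 0 ≤ s)
    (hs : s < T₀) : ∃ j : ℕ, s ∈ Ico (t j) (t (j + 1)) := by
  classical
  have hev : ∃ j : ℕ, s < t j := (hT.eventually (lt_mem_nhds hs)).exists
  have hj0 : Nat.find hev ≠ 0 := by
    intro h0
    have h := Nat.find_spec hev
    rw [h0] at h
    exact absurd h (not_lt.2 hs₀)
  obtain ⟨i, hi⟩ := Nat.exists_eq_succ_of_ne_zero hj0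
  refine ⟨i, not_lt.1 (Nat.find_min hev (show i < Nat.find hev by rw [hi]; exact i.lt_succ_self)),
    ?_⟩
  simpa [hi] using Nat.find_spec hev

/-- The piece index is unique. [folklore] -/
theorem eq_of_mem_Ico_of_strictMono (ht : StrictMono t) {s : ℝ} {j k : ℕ}
    (hj : s ∈ Ico (t j) (t (j + 1))) (hk : s ∈ Ico (t k) (t (k + 1))) : j = k := by
  by_contra hne
  rcases Nat.lt_or_gt_of_ne hne with h | h
  · exact absurd (hj.2.trans_le ((ht.monotone (Nat.succ_le_of_lt h)).trans hk.1)) (lt_irrefl s)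
  · exact absurd (hk.2.trans_le ((ht.monotone (Nat.succ_le_of_lt h)).trans hj.1)) (lt_irrefl s)

/-- The pieces are pairwise disjoint. [folklore] -/
theorem pairwise_disjoint_Ico_of_strictMono (ht : StrictMono t) :
    Pairwise (Disjoint on fun j => Ico (t j) (t (j + 1))) := fun _ _ hjk =>
  disjoint_left.2 fun _ hsj hsk => hjk (eq_of_mem_Ico_of_strictMono ht hsj hsk)

/-- **The pieces partition `[t₀, T₀)`.** [cite: Ozanski2017NSISingular, §2 (2.4)] -/
theorem iUnion_Ico_eq_of_strictMono_tendsto (ht : StrictMono t) (hT : Tendsto t atTop (𝓝 T₀)) :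
    ⋃ j : ℕ, Ico (t j) (t (j + 1)) = Ico (t 0) T₀ := by
  ext s
  simp only [mem_iUnion, mem_Ico]
  constructor
  · rintro ⟨j, hj, hj'⟩
    exact ⟨(ht.monotone (Nat.zero_le j)).trans hj, hj'.trans (lt_of_strictMono_tendsto ht hT _)⟩
  · rintro ⟨h₀, h₁⟩
    obtain ⟨j, hj⟩ := exists_mem_Ico_of_strictMono_tendsto hT h₀ h₁
    exact ⟨j, hj.1, hj.2⟩

omit [NormedAddCommGroup E] [InnerProductSpace ℝ E] [FiniteDimensional ℝ E] [BorelSpace E] in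
/-- The space–time strips `[t_j, t_{j+1}) × E` are measurable. [folklore] -/
theorem measurableSet_strip (j : ℕ) : MeasurableSet (Ico (t j) (t (j + 1)) ×ˢ (univ : Set E)) :=
  measurableSet_Ico.prod MeasurableSet.univ

omit [NormedAddCommGroup E] [InnerProductSpace ℝ E] [FiniteDimensional ℝ E] [MeasurableSpace E]
  [BorelSpace E] in
/-- The space–time strips are pairwise disjoint. [folklore] -/
theorem pairwise_disjoint_strip (ht : StrictMono t) :
    Pairwise (Disjoint on fun j => Ico (t j) (t (j + 1)) ×ˢ (univ : Set E)) := fun _ _ hjk =>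
  Set.disjoint_prod.2 (Or.inl (pairwise_disjoint_Ico_of_strictMono ht hjk))

omit [NormedAddCommGroup E] [InnerProductSpace ℝ E] [FiniteDimensional ℝ E] [MeasurableSpace E]
  [BorelSpace E] in
/-- The union of the strips is `[t₀, T₀) × E`. [folklore] -/
theorem iUnion_strip_eq (ht : StrictMono t) (hT : Tendsto t atTop (𝓝 T₀)) :
    ⋃ j : ℕ, Ico (t j) (t (j + 1)) ×ˢ (univ : Set E) = Ico (t 0) T₀ ×ˢ univ := by
  rw [← iUnion_prod_const, iUnion_Ico_eq_of_strictMono_tendsto ht hT]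

/-- A slice `{a} × E` is Lebesgue-null in space–time. [folklore] -/
theorem volume_singleton_prod_univ (a : ℝ) : volume (({a} : Set ℝ) ×ˢ (univ : Set E)) = 0 := by
  rw [Measure.volume_eq_prod, Measure.prod_prod, Real.volume_singleton, zero_mul]

/-- The half-open and the open strip agree up to a null set. [folklore] -/
theorem Ico_prod_ae_eq_Ioo_prod (a b : ℝ) :
    (Ico a b ×ˢ (univ : Set E) : Set (ℝ × E)) =ᵐ[volume] (Ioo a b ×ˢ (univ : Set E) : Set (ℝ × E)) := by
  have h0 : (({a} : Set ℝ) ×ˢ (univ : Set E) : Set (ℝ × E)) =ᵐ[volume] (∅ : Set (ℝ × E)) :=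
    ae_eq_empty.2 (volume_singleton_prod_univ a)
  have h1 : (Ioo a b ×ˢ (univ : Set E) ∪ ({a} : Set ℝ) ×ˢ (univ : Set E) : Set (ℝ × E)) =ᵐ[volume]
      (Ioo a b ×ˢ (univ : Set E) : Set (ℝ × E)) :=
    union_ae_eq_left_of_ae_eq_empty h0
  have hsub1 : (Ioo a b ×ˢ (univ : Set E) : Set (ℝ × E)) ⊆ Ico a b ×ˢ univ :=
    prod_mono Ioo_subset_Ico_self Subset.rfl
  have hsub2 : (Ico a b ×ˢ (univ : Set E) : Set (ℝ × E)) ⊆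
      Ioo a b ×ˢ (univ : Set E) ∪ ({a} : Set ℝ) ×ˢ (univ : Set E) := by
    rintro ⟨s, x⟩ ⟨hs, -⟩
    rcases hs.1.eq_or_lt with h | h
    · exact Or.inr ⟨by rw [mem_singleton_iff]; exact h.symm, mem_univ _⟩
    · exact Or.inl ⟨⟨h, hs.2⟩, mem_univ _⟩
  exact (hsub2.eventuallyLE.trans h1.le).antisymm hsub1.eventuallyLE

/-- Integrals over the open and the half-open strip agree. [folklore] -/
theorem setIntegral_Ioo_prod_eq_Ico_prod (F : ℝ × E → ℝ) (a b : ℝ) :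
    ∫ z in Ioo a b ×ˢ (univ : Set E), F z = ∫ z in Ico a b ×ˢ (univ : Set E), F z :=
  setIntegral_congr_set (Ico_prod_ae_eq_Ioo_prod a b).symm

end Partition

/-! ### Slice identities -/

section Slice

/-- **Divergence-free `C¹` fields are weakly divergence free, slice form**: `∫ ⟪V, ∇θ⟫ = 0` for
`V ∈ C¹(E; E)` with `div V = 0` and `θ ∈ C¹_c` (`∫ θ div V + ∫ ⟪V, ∇θ⟫ = 0`, `WholeSpaceIBP`).
[folklore] -/
theorem integral_inner_gradient_eq_zero_of_isDivFree {V : E → E} {θ : E → ℝ}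
    (hV : ContDiff ℝ 1 V) (hdiv : VectorCalculus.IsDivFree V) (hθ : ContDiff ℝ 1 θ)
    (hθc : HasCompactSupport θ) : ∫ x, ⟪V x, gradient θ x⟫ = 0 := by
  have h := integral_mul_divergence_add_eq_zero_left hθ hV hθc
  have h0 : ∫ x, θ x * VectorCalculus.divergence V x = 0 := by
    simp [hdiv _]
  rw [h0, zero_add] at h
  exact h

/-- **Integration by parts against a direction, slice form**:
`∫ ∂ᵥφ ⟪V, w⟫ = -∫ φ ⟪DV v, w⟫` for `V ∈ C¹(E; E)`, `φ ∈ C¹_c` (the slice step of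
`hasWeakSpatialGradientOn_of_contDiffOn`, `ClassicalSuitable`). [folklore] -/
theorem integral_fderiv_mul_inner_eq_neg {V : E → E} {φ : E → ℝ} (hV : ContDiff ℝ 1 V)
    (hφ : ContDiff ℝ 1 φ) (hφc : HasCompactSupport φ) (v w : E) :
    ∫ x, fderiv ℝ φ x v * ⟪V x, w⟫ = -∫ x, φ x * ⟪fderiv ℝ V x v, w⟫ := by
  set h : E → ℝ := fun x => φ x * ⟪V x, w⟫ with hh
  have hh1 : ContDiff ℝ 1 h := hφ.mul (hV.inner ℝ contDiff_const)
  have hhc : HasCompactSupport h := hφc.mul_right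
  have h0 := integral_fderiv_apply_eq_zero hh1 hhc v
  have hD : ∀ x, fderiv ℝ h x v =
      fderiv ℝ φ x v * ⟪V x, w⟫ + φ x * ⟪fderiv ℝ V x v, w⟫ := by
    intro x
    have h1 := ((hV.differentiable one_ne_zero x).hasFDerivAt).inner ℝ (hasFDerivAt_const w x)
    have h2 : HasFDerivAt h _ x := ((hφ.differentiable one_ne_zero x).hasFDerivAt).mul h1
    rw [h2.fderiv]
    simp only [add_apply, smul_apply, smul_eq_mul,
      ContinuousLinearMap.comp_apply, fderivInnerCLM_apply, ContinuousLinearMap.prod_apply,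
      inner_zero_right, zero_add, zero_apply]
    ring
  have i1 : Integrable (fun x => fderiv ℝ φ x v * ⟪V x, w⟫) (volume : Measure E) :=
    (((hφ.continuous_fderiv one_ne_zero).clm_apply continuous_const).mul
      (hV.continuous.inner continuous_const)).integrable_of_hasCompactSupport
      ((hφc.fderiv_apply (𝕜 := ℝ) v).mul_right)
  have i2 : Integrable (fun x => φ x * ⟪fderiv ℝ V x v, w⟫) (volume : Measure E) :=
    (hφ.continuous.mul (((hV.continuous_fderiv one_ne_zero).clm_apply
      continuous_const).inner continuous_const)).integrable_of_hasCompactSupport hφc.mul_right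
  simp_rw [hD] at h0
  rw [integral_add i1 i2] at h0
  linarith

end Slice

/-! ### Piecewise-classical fields: weak spatial gradient and weak divergence -/

section Piecewise

variable {t : ℕ → ℝ} {T₀ : ℝ} {𝔲 : ℝ → E → E} {Gr : ℝ → E → E →L[ℝ] E}
  {v : ℕ → ℝ → E → E}

omit [FiniteDimensional ℝ E] [MeasurableSpace E] [BorelSpace E] in
/-- A space–time test function on `(0,∞) × E` vanishes, with all its slices, at times `s ≤ 0`. [folklore] -/
theorem slice_eq_zero_of_nonpos {F : Type*} [NormedAddCommGroup F] [NormedSpace ℝ F]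
    {φ : ℝ → E → F} (hφ : IsSpaceTimeTestOn (slab E (Ioi 0) isOpen_Ioi) φ) {s : ℝ} (hs : s ≤ 0) : φ s = 0 :=
  funext fun x => hφ.apply_eq_zero fun h => by
    rw [coe_slab] at h
    exact absurd (mem_prod.1 h).1 (not_lt.2 hs)

/-- **Trichotomy of times for a piecewise field**: every `s : ℝ` is nonpositive, lies in a piece
`[t_j, t_{j+1})`, or is `≥ T₀` (for `t₀ = 0`, `t_j ↑ T₀`). [folklore] -/
theorem time_trichotomy (h0 : t 0 = 0) (hT : Tendsto t atTop (𝓝 T₀)) (s : ℝ) :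
    s ≤ 0 ∨ (∃ j, s ∈ Ico (t j) (t (j + 1))) ∨ T₀ ≤ s := by
  by_cases hs : s ≤ 0
  · exact Or.inl hs
  by_cases hs' : T₀ ≤ s
  · exact Or.inr (Or.inr hs')
  refine Or.inr (Or.inl (exists_mem_Ico_of_strictMono_tendsto hT ?_ (not_le.1 hs')))
  rw [h0]; exact (not_le.1 hs).le

/-- **The glued slice derivative is a weak spatial gradient of the glued field.** Let
`0 = t₀ < t₁ < ⋯ → T₀`, and let `𝔲`, `Gr` agree on each piece `[t_j, t_{j+1})` with `C¹` slices
`v_j(s)` and their derivatives, and vanish from `T₀` on. If `𝔲` and `Gr` are integrable on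
`(0,∞) × E`, then `Gr` is a weak spatial gradient of `𝔲` there in the sense of the accepted
`HasWeakSpatialGradientOn` (integration by parts slice by slice; Caffarelli–Kohn–Nirenberg 1982,
(2.1), for piecewise smooth fields). [cite: Ozanski2017NSISingular, §2 p. 7] -/
theorem hasWeakSpatialGradientOn_of_piecewise (ht : StrictMono t) (h0 : t 0 = 0)
    (hT : Tendsto t atTop (𝓝 T₀))
    (hagree : ∀ j, ∀ s ∈ Ico (t j) (t (j + 1)), 𝔲 s = v j s ∧ Gr s = fun x => fderiv ℝ (v j s) x)
    (hzero : ∀ s, T₀ ≤ s → 𝔲 s = 0 ∧ Gr s = 0)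
    (hC1 : ∀ j, ∀ s ∈ Ico (t j) (t (j + 1)), ContDiff ℝ 1 (v j s))
    (hint𝔲 : IntegrableOn (uncurry 𝔲) ((slab E (Ioi 0) isOpen_Ioi : Opens (ℝ × E)) : Set (ℝ × E)) volume)
    (hintG : IntegrableOn (uncurry Gr) ((slab E (Ioi 0) isOpen_Ioi : Opens (ℝ × E)) : Set (ℝ × E)) volume) :
    HasWeakSpatialGradientOn (slab E (Ioi 0) isOpen_Ioi) 𝔲 Gr where
  locallyIntegrableOn := hint𝔲.locallyIntegrableOn
  locallyIntegrableOn_grad := hintG.locallyIntegrableOn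
  integral_fderiv_mul_inner_eq φ hφ a w := by
    have _ := ht
    rw [← integral_neg]
    refine integral_congr_ae (Eventually.of_forall fun s => ?_)
    rcases time_trichotomy h0 hT s with hs | ⟨j, hj⟩ | hs
    · simp [slice_eq_zero_of_nonpos hφ hs]
    · obtain ⟨hu, hG⟩ := hagree j s hj
      have hφ1 : ContDiff ℝ 1 (φ s) := (hφ.contDiff_slice s).of_le (by exact_mod_cast le_top)
      simp only [hu, hG]
      exact integral_fderiv_mul_inner_eq_neg (hC1 j s hj) hφ1 (hφ.hasCompactSupport_slice s) a w
    · obtain ⟨hu, hG⟩ := hzero s hs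
      simp [hu, hG]

/-- **The glued field is weakly divergence free on `(0,∞) × E`**: each `C¹` slice `v_j(s)` is
divergence free, so `∫ ⟪𝔲(s), ∇θ(s)⟫ = 0` for every `s`, and the space–time integral over
`(0,∞) × E` is the iterated one (Fubini: `𝔲` integrable, `∇θ` bounded).
[cite: Ozanski2017NSISingular, §2 p. 7] -/
theorem integral_inner_gradient_eq_zero_of_piecewise (h0 : t 0 = 0) (hT : Tendsto t atTop (𝓝 T₀))
    (hagree : ∀ j, ∀ s ∈ Ico (t j) (t (j + 1)), 𝔲 s = v j s)
    (hzero : ∀ s, T₀ ≤ s → 𝔲 s = 0)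
    (hC1 : ∀ j, ∀ s ∈ Ico (t j) (t (j + 1)), ContDiff ℝ 1 (v j s))
    (hdiv : ∀ j, ∀ s ∈ Ico (t j) (t (j + 1)), VectorCalculus.IsDivFree (v j s))
    (hint𝔲 : IntegrableOn (uncurry 𝔲) ((slab E (Ioi 0) isOpen_Ioi : Opens (ℝ × E)) : Set (ℝ × E)) volume)
    {θ : ℝ → E → ℝ} (hθ : IsSpaceTimeTestOn (slab E (Ioi 0) isOpen_Ioi) θ) :
    ∫ z in ((slab E (Ioi 0) isOpen_Ioi : Opens (ℝ × E)) : Set (ℝ × E)), ⟪𝔲 z.1 z.2, gradient (θ z.1) z.2⟫ = 0 := by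
  -- the integrand vanishes off `Q`, and is integrable on `Q`
  set F : ℝ × E → ℝ := fun z => ⟪𝔲 z.1 z.2, gradient (θ z.1) z.2⟫ with hF
  have hF0 : ∀ z ∉ ((slab E (Ioi 0) isOpen_Ioi : Opens (ℝ × E)) : Set (ℝ × E)), F z = 0 := fun z hz => by
    have : gradient (θ z.1) z.2 = 0 :=
      gradient_eq_zero_of_notMem_tsupport (notMem_tsupport_slice_of_notMem
        fun h => hz (hθ.tsupport_subset h))
    show ⟪𝔲 z.1 z.2, gradient (θ z.1) z.2⟫ = 0
    rw [this, inner_zero_right]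
  obtain ⟨C, hC⟩ := (hθ.hasCompactSupport.isCompact.image hθ.continuous_slice_gradient).isBounded.exists_norm_le
  have hgrad_bd : ∀ z : ℝ × E, ‖gradient (θ z.1) z.2‖ ≤ max C 0 := by
    intro z
    by_cases hz : z ∈ tsupport (uncurry θ)
    · exact (hC _ ⟨z, hz, rfl⟩).trans (le_max_left _ _)
    · rw [gradient_eq_zero_of_notMem_tsupport (notMem_tsupport_slice_of_notMem hz), norm_zero]
      exact le_max_right _ _
  have hFint : IntegrableOn F ((slab E (Ioi 0) isOpen_Ioi : Opens (ℝ × E)) : Set (ℝ × E)) volume := by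
    refine Integrable.mono' (hint𝔲.norm.mul_const (max C 0)) ?_ (Eventually.of_forall fun z => ?_)
    · exact hint𝔲.aestronglyMeasurable.inner
        hθ.continuous_slice_gradient.aestronglyMeasurable
    · rw [hF]
      exact (norm_inner_le_norm _ _).trans (mul_le_mul_of_nonneg_left (hgrad_bd z) (norm_nonneg _))
  have hFint' : Integrable F (volume : Measure (ℝ × E)) :=
    hFint.integrable_of_forall_notMem_eq_zero hF0
  rw [setIntegral_eq_integral_of_forall_compl_eq_zero fun z hz => hF0 z hz,
    Measure.volume_eq_prod, integral_prod _ (by rwa [← Measure.volume_eq_prod])]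
  refine integral_eq_zero_of_ae (Eventually.of_forall fun s => ?_)
  rcases time_trichotomy h0 hT s with hs | ⟨j, hj⟩ | hs
  · simp [hF, slice_eq_zero_of_nonpos hθ hs]
  · have hθ1 : ContDiff ℝ 1 (θ s) := (hθ.contDiff_slice s).of_le (by exact_mod_cast le_top)
    simp only [hF, hagree j s hj]
    exact integral_inner_gradient_eq_zero_of_isDivFree (hC1 j s hj) (hdiv j s hj) hθ1
      (hθ.hasCompactSupport_slice s)
  · simp [hF, hzero s hs]

end Piecewise

end Literature.Barriers.NavierStokesRegularity

end
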